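import Summits.PneNP.PneNP.Theses.CanonicalForms
import Literature.Computability.Complexity.SearchToDecision
import Literature.Computability.Complexity.CodeFPArith
import Literature.Computability.Complexity.StringCopy

/-!
# Route CanonicalForms — `CanonOfPEqNP` (stmt-PneNP-0952)

Blass–Gurevich / Fortnow–Grochow "first canonical form" under `P = NP`: for a polynomial-time decidable equivalence `E`
there is an `FP` canonical form. We run the tree's suffix search (`searchFn` of `SearchToDecision.lean`, Arora–Barak
Thm. 2.18) on the relation `R = {⟨x, w⟩ | E w x ∧ no E-equivalent of x is shorter than w}` with bound `p = X`:
`R ∈ P` (the first conjunct is the hypothesis, the second the complement of an `NP` predicate), every `x` is solvable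
(a shortest member of its class), so the search returns an `E`-equivalent of `x`. CANONICITY: membership
`⟨x, w⟩ ∈ R` and the feasibility test `⟨x, 0w⟩ ∈ SuffExt R X` depend on `x` only through its class (solutions are
shortest members, so the length bound `≤ |x|` is never active), hence the rounds starting from `⟨x, ε⟩` and `⟨y, ε⟩`
for `E x y` carry the same second component, which is frozen once it solves `R` (after `≤ min(|x|, |y|)` rounds).
-/

set_option linter.dupNamespace false -- `Summit.PneNP.PneNP.…`: summit = sub-problem name (D-0017 single-conjunct layout)

namespace Summit.PneNP.PneNP.Theorems

open _root_.Computability Polynomial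
open Literature.Computability.Complexity Literature.Computability.Complexity.CodeFP
  Literature.Computability.Complexity.Brick

section Canon

variable {E : List Bool → List Bool → Prop}

/-- Rounds of the suffix search keep the instance and, once the word solves `R`, freeze. [cite: AroraBarakCC2009, Thm. 2.18] [folklore] -/
theorem canonicalForms_iterate_frozen (R : Language Bool) (p : Polynomial ℕ) (x w : List Bool) (hw : boolPair x w ∈ R) :
    ∀ j : ℕ, (roundFn R p)^[j] (boolPair x w) = boolPair x w
  | 0 => rfl
  | j + 1 => by
    classical
    rw [Function.iterate_succ_apply, roundFn_boolPair, if_pos hw]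
    exact canonicalForms_iterate_frozen R p x w hw j

/-- **Class invariance of the rounds**: if membership in `R` and in `SuffExt R p` of the words `⟨·, w⟩` does not
distinguish `x` from `y`, the rounds from `⟨x, ε⟩` and `⟨y, ε⟩` carry the same second component. [folklore] -/
theorem canonicalForms_iterate_agree (R : Language Bool) (p : Polynomial ℕ) (x y : List Bool)
    (hR : ∀ w, boolPair x w ∈ R ↔ boolPair y w ∈ R)
    (hS : ∀ w, boolPair x w ∈ SuffExt R p ↔ boolPair y w ∈ SuffExt R p) :
    ∀ k : ℕ, ∃ w : List Bool, (roundFn R p)^[k] (boolPair x []) = boolPair x w ∧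
      (roundFn R p)^[k] (boolPair y []) = boolPair y w
  | 0 => ⟨[], rfl, rfl⟩
  | k + 1 => by
    classical
    obtain ⟨w, hx, hy⟩ := canonicalForms_iterate_agree R p x y hR hS k
    rw [Function.iterate_succ_apply', Function.iterate_succ_apply', hx, hy, roundFn_boolPair, roundFn_boolPair]
    by_cases h1 : boolPair x w ∈ R
    · exact ⟨w, by rw [if_pos h1], by rw [if_pos ((hR w).1 h1)]⟩
    · rw [if_neg h1, if_neg fun h => h1 ((hR w).2 h)]
      by_cases h2 : boolPair x (false :: w) ∈ SuffExt R p
      · exact ⟨false :: w, by rw [if_pos h2], by rw [if_pos ((hS _).1 h2)]⟩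
      · exact ⟨true :: w, by rw [if_neg h2], by rw [if_neg fun h => h2 ((hS _).2 h)]⟩

end Canon

/-- **Support item `CanonOfPEqNP` of route CanonicalForms (stmt-PneNP-0952)**: under `P = NP`, every polynomial-time
decidable equivalence relation on strings has an `FP` canonical form (suffix search for a SHORTEST equivalent, on the
relation "`E w x` and nothing shorter is equivalent to `x`", which is in `P` as `NP = coNP = P`).
[cite: BlassGurevich1984, §1] [cite: AroraBarakCC2009, Thm. 2.18] -/
theorem canonicalForms_canonOfPEqNP_proof : Summit.PneNP.PneNP.Theses.CanonicalForms.CanonOfPEqNP := by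
  intro hPNP E hE hEP
  have hNP : Nondeterministic.NP ⊆ Classes.P := hPNP.symm.subset
  -- `A = {⟨x, w⟩ | E w x} ∈ P` (swap the pair, ask the hypothesis)
  set LE : Language Bool := {w | ∃ x y, w = boolPair x y ∧ E x y} with hLE
  have hLEiff : ∀ a b : List Bool, boolPair a b ∈ LE ↔ E a b := by
    intro a b
    refine ⟨?_, fun h => ⟨a, b, rfl, h⟩⟩
    rintro ⟨a', b', heq, h⟩
    have := congrArg boolUnpair heq
    rw [boolUnpair_boolPair, boolUnpair_boolPair] at this
    obtain ⟨rfl, rfl⟩ := Prod.mk.inj this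
    exact h
  set A : Language Bool := (fanoutFn sndF fstF) ⁻¹' LE with hA
  have hAP : A ∈ Classes.P := preimage_mem_P hEP (fanoutFn_mem_FP sndF_mem_FP fstF_mem_FP)
  have hAiff : ∀ x w : List Bool, boolPair x w ∈ A ↔ E w x := by
    intro x w
    change fanoutFn sndF fstF (boolPair x w) ∈ LE ↔ _
    rw [fanoutFn_apply, sndF_boolPair, fstF_boolPair, hLEiff]
  -- `B = {⟨x, w⟩ | ∃ z shorter than w with E z x} ∈ NP ⊆ P`
  have hind : CodeFP strE bitE fun u : List Bool => LE.boolIndicator u :=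
    CodeFP.of_fn _ (indicatorFn_mem_FP hEP) fun _ => rfl
  have htest : CodeFP (pairE (pairE strE strE) strE) bitE fun t : (List Bool × List Bool) × List Bool =>
      decide (t.2.length < t.1.2.length) && LE.boolIndicator (boolPair t.2 t.1.1) := by
    have hl1 : CodeFP (pairE (pairE strE strE) strE) natE fun t : (List Bool × List Bool) × List Bool => t.2.length :=
      (natOfUn.comp (strLength.comp (CodeFP.snd _ _)) :)
    have hl2 : CodeFP (pairE (pairE strE strE) strE) natE fun t : (List Bool × List Bool) × List Bool => t.1.2.length :=
      (natOfUn.comp (strLength.comp (CodeFP.fst _ _).snd') :)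
    have hpair : CodeFP (pairE (pairE strE strE) strE) strE fun t : (List Bool × List Bool) × List Bool =>
        boolPair t.2 t.1.1 :=
      (((CodeFP.snd _ _).pair (CodeFP.fst _ _).fst').recodeOut fun _ => rfl :)
    exact (natLt.comp (hl1.pair hl2)).and (hind.comp hpair)
  obtain ⟨g, hg, hgspec⟩ := htest
  set VB : Language Bool := (g ∘ fanoutFn fstF sndF) ⁻¹' PRelSigma.HeadIs true with hVB
  have hVBP : VB ∈ Classes.P :=
    preimage_mem_P (PRelSigma.HeadIs_mem_P true) (comp_mem_FP hg (fanoutFn_mem_FP fstF_mem_FP sndF_mem_FP))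
  have hVBiff : ∀ x w z : List Bool, boolPair (boolPair x w) z ∈ VB ↔ z.length < w.length ∧ E z x := by
    intro x w z
    change (g ∘ fanoutFn fstF sndF) (boolPair (boolPair x w) z) ∈ PRelSigma.HeadIs true ↔ _
    simp only [Function.comp_apply, fanoutFn_apply, fstF_boolPair, sndF_boolPair, PRelSigma.mem_HeadIs]
    rw [show boolPair (boolPair x w) z = pairE (pairE strE strE) strE ((x, w), z) from rfl, hgspec]
    simp only [bitE, List.head?_cons, Option.some.injEq, Bool.and_eq_true, decide_eq_true_eq]
    rw [← hLEiff z x]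
    exact and_congr_right fun _ => (Set.mem_iff_boolIndicator _ _).symm
  set B : Language Bool := {u | ∃ z : List Bool, z.length ≤ (X : Polynomial ℕ).eval u.length ∧ boolPair u z ∈ VB} with hB
  have hBNP : B ∈ Nondeterministic.NP := ⟨VB, hVBP, X, fun u => Iff.rfl⟩
  have hBiff : ∀ x w : List Bool, boolPair x w ∈ B ↔ ∃ z : List Bool, z.length < w.length ∧ E z x := by
    intro x w
    constructor
    · rintro ⟨z, -, hz⟩
      exact ⟨z, (hVBiff x w z).1 hz⟩
    · rintro ⟨z, hz⟩
      refine ⟨z, ?_, (hVBiff x w z).2 hz⟩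
      rw [eval_X, length_boolPair]
      omega
  -- the relation
  set R : Language Bool := A ⊓ Bᶜ with hRdef
  have hRP : R ∈ Classes.P := inter_mem_P hAP (compl_mem_P_iff.2 (hNP hBNP))
  have hRiff : ∀ x w : List Bool, boolPair x w ∈ R ↔ E w x ∧ ∀ z : List Bool, z.length < w.length → ¬ E z x := by
    intro x w
    change boolPair x w ∈ A ∧ boolPair x w ∉ B ↔ _
    rw [hAiff, hBiff]
    simp only [not_exists, not_and]
  -- every instance is solvable: a shortest member of its class
  have hsolv : ∀ x : List Bool, ∃ w : List Bool, w.length ≤ (X : Polynomial ℕ).eval x.length ∧ boolPair x w ∈ R := by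
    intro x
    classical
    have hne : ∃ n, ∃ z : List Bool, z.length = n ∧ E z x := ⟨x.length, x, rfl, hE.refl x⟩
    obtain ⟨z, hz, hzE⟩ := Nat.find_spec hne
    refine ⟨z, ?_, (hRiff x z).2 ⟨hzE, fun z' hz' hz'E => ?_⟩⟩
    · rw [eval_X, hz]
      exact Nat.find_min' hne ⟨x, rfl, hE.refl x⟩
    · exact Nat.find_min hne (hz ▸ hz') ⟨z', rfl, hz'E⟩
  -- lengths of solutions never exceed the length of any member of the class
  have hshort : ∀ x u y : List Bool, boolPair x u ∈ R → E x y → u.length ≤ y.length := by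
    intro x u y hu hxy
    obtain ⟨-, hmin⟩ := (hRiff x u).1 hu
    by_contra h
    exact hmin y (not_le.1 h) (hE.symm hxy)
  -- the canonical form
  refine ⟨searchFn R X, searchFn_mem_FP R X hRP (hNP (SuffExt_mem_NP R X hRP)), fun x => ?_, fun x y hxy => ?_⟩
  · exact ((hRiff x _).1 (searchFn_spec (R := R) (p := X) x (hsolv x)).2).1
  · -- class invariance of the two tests
    have hRclass : ∀ w, boolPair x w ∈ R ↔ boolPair y w ∈ R := by
      intro w
      rw [hRiff, hRiff]
      refine and_congr ⟨fun h => hE.trans h hxy, fun h => hE.trans h (hE.symm hxy)⟩ (forall_congr' fun z => ?_)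
      exact imp_congr_right fun _ => not_congr ⟨fun h => hE.trans h hxy, fun h => hE.trans h (hE.symm hxy)⟩
    have hSclass : ∀ w, boolPair x w ∈ SuffExt R X ↔ boolPair y w ∈ SuffExt R X := by
      intro w
      rw [boolPair_mem_SuffExt, boolPair_mem_SuffExt, eval_X, eval_X]
      constructor
      · rintro ⟨v, -, hv⟩
        exact ⟨v, hshort x _ y hv hxy, (hRclass _).1 hv⟩
      · rintro ⟨v, -, hv⟩
        have hv' := (hRclass _).2 hv
        exact ⟨v, hshort x _ x hv' (hE.refl x), hv'⟩
    -- both searches end frozen on the same word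
    obtain ⟨wx, hkx, hwxR, -⟩ := iterate_roundFn_spec (R := R) (p := X) x (hsolv x)
    obtain ⟨wy, hky, hwyR, -⟩ := iterate_roundFn_spec (R := R) (p := X) y (hsolv y)
    have key : ∀ m : ℕ, (X : Polynomial ℕ).eval x.length ≤ m → (X : Polynomial ℕ).eval y.length ≤ m →
        wx = wy := by
      intro m hmx hmy
      obtain ⟨w, hxm, hym⟩ := canonicalForms_iterate_agree R X x y hRclass hSclass m
      have e1 : (roundFn R X)^[m] (boolPair x []) = boolPair x wx := by
        rw [show m = (m - (X : Polynomial ℕ).eval x.length) + (X : Polynomial ℕ).eval x.length by omega,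
          Function.iterate_add_apply, hkx, canonicalForms_iterate_frozen R X x wx hwxR]
      have e2 : (roundFn R X)^[m] (boolPair y []) = boolPair y wy := by
        rw [show m = (m - (X : Polynomial ℕ).eval y.length) + (X : Polynomial ℕ).eval y.length by omega,
          Function.iterate_add_apply, hky, canonicalForms_iterate_frozen R X y wy hwyR]
      have h1 : wx = w := by
        have := congrArg boolUnpair (e1.symm.trans hxm)
        rw [boolUnpair_boolPair, boolUnpair_boolPair] at this
        exact (Prod.mk.inj this).2
      have h2 : wy = w := by
        have := congrArg boolUnpair (e2.symm.trans hym)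
        rw [boolUnpair_boolPair, boolUnpair_boolPair] at this
        exact (Prod.mk.inj this).2
      rw [h1, h2]
    have hsx : searchFn R X x = wx := by
      simp only [searchFn, Function.comp_apply, boolUnpair_boolPair]
      rw [hkx, boolUnpair_boolPair]
    have hsy : searchFn R X y = wy := by
      simp only [searchFn, Function.comp_apply, boolUnpair_boolPair]
      rw [hky, boolUnpair_boolPair]
    rw [hsx, hsy]
    exact key _ (le_max_left _ _) (le_max_right _ _)

end Summit.PneNP.PneNP.Theorems
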